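import Summits.QuantumFields.YangMills.Theorems.UniversalDetectorHankelMirror
import Summits.QuantumFields.YangMills.Theorems.LangevinControlUVOSLegsFromFemtoAndGapStubAssemblyPermutations
import Summits.QuantumFields.YangMills.Theorems.LangevinControlUVOSLegsFromFemtoAndGapStubAssemblyPlaneStrings
import Summits.QuantumFields.YangMills.Theorems.BalabanLadderNTCumulantPolarisationDefs
import Summits.QuantumFields.YangMills.Theorems.UniversalDetectorTightPeelingPrep
import Summits.QuantumFields.YangMills.Theses.UniversalDetector
import HarnessLib

/-!
# Route `UniversalDetector`, LINE g10-1 «Hankel tightness» — proof of the support item `HankelCeiling`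

Ideator seat ym-idea-8 (generation 10, lens «dual»); closes the support item `UniversalDetector.HankelCeiling`
(stmt-QuantumFields-24000) of rung R2a (`BalabanLadder.NT`): for EVERY compact `G`, lattice representation `r` and unit
`a → 0`, the one-annulus diagonal ceiling (EDGE) of the crux `SchemeEdgeLaws` — `|a⁻⁸ Cov_T(P_q(0), P_q(m e_k))| ≤ C(η)`
for the lags of ONE femto annulus `η ≤ a m ≤ 2η`, `η ≤ η₀` — implies the boundedness clause of TIGHT6: every plane
kernel `a⁻⁸ Cov_T(P_p(0), P_q(z))` is bounded on the whole box off every femto ball `‖a z‖ ≥ η` (by the EDGE constant at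
the scale `η' = min(η/8, η₀)`).

Mechanism (the «dual» use of reflection positivity — ceilings instead of floors):
* `cov_plane_perm` — plane–plane covariances are invariant under coordinate permutations (soft OS-assembly toolkit
  XXIII), so the dominant coordinate of `z` may be taken to be Euclidean time, and by evenness positive;
* `sq_cov_plane_le_edge` — CENTRING on the reflection hyperplane writes the covariance as a mirror pairing; the
  two-observable RPCS bounds its square by two DIAGONAL time-axis kernels at lags `≈ z₀`, and the Hankel maximum
  principle of `UniversalDetectorHankelMirror` (non-negative log-convex mirror sequences, symmetric about the antipode
  by periodicity and evenness) bounds those by the diagonal kernels at the EDGE lag `m_e = ⌈η'/a⌉`;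
* `universalDetector_hankelCeiling` — bookkeeping of the scales (`a ≤ η'/5` eventually, `m_e ≥ 5`, `m_e + 2 ≤ ‖z‖_∞`
  from `‖a z‖₂ ≥ η`, `a L ≥ 2η'`).

NEIGHBOUR IN THE TREE: the RPCS domination of a pair covariance by two on-axis same-orientation mirror covariances is
also the mechanism of `Theorems/SquareRootCeilingsMirrorDomination` (route `SquareRootCeilings`, support
`MirrorDomination`, which ASSUMES the axis ceiling at every separation `2R+2 ≤ t ≤ L`); the present line assumes the
ceiling on ONE femto annulus only and lets the Hankel maximum principle (`diagCov_le_edge`: a non-negative log-convex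
diagonal sequence, symmetric about the antipode, is maximal at the window edge) supply every other lag.

HONEST FRAMING: this is an implication between lattice statements at a unit `a` (EDGE ⇒ boundedness), valid for every
compact group; it proves no ceiling unconditionally, and no summit, rung or crux; the crux `SchemeEdgeLaws` (EDGE ∧
TRANS ∧ NONCONTACT at one unit) stays open; not Clay.  Refs: Fröhlich–Israel–Lieb–Simon, Comm. Math. Phys. 62 (1978)
Thm. 2.1; Osterwalder–Seiler, Ann. Phys. 110 (1978) §2; Glimm–Jaffe, *Quantum Physics* (1987) §6.1, §19 [folklore].
-/

set_option autoImplicit false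

noncomputable section

open MeasureTheory Filter Topology
open Literature.MathematicalPhysics.QuantumFieldTheory Literature.MathematicalPhysics.QuantumLattice
  Literature.Probability.LatticeModels
open Summit.QuantumFields.YangMills.Cruxes.OSLegsFromFemtoAndGap.DlrCollarTransfer
open Summit.QuantumFields.YangMills.Cruxes.UniversalDetectorPlaneTight (cov_plane_zero_neg)

namespace Summit.QuantumFields.YangMills.Cruxes.UniversalDetectorHankel

open Summit.QuantumFields.YangMills.Theorems.OSLegsFromFemtoAndGap (permPlane permSites permPlane_valid
  torusMomentStr_coordPerm torusE_prod_plane_eq_torusMomentStr wilsonTorusMean_permPlane)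
open Summit.QuantumFields.YangMills.Cruxes.NT.CumulantPolarisation (torusE_centred_centred)
open Summit.QuantumFields.YangMills.Cruxes.UniversalDetectorTightPeeling (norm_siteToE_le_two_mul norm_smul_siteToE)

variable (G : Type) [Group G] [TopologicalSpace G] [IsTopologicalGroup G] [CompactSpace G]
  [MeasurableSpace G] [BorelSpace G] (r : LatticeRep G)

/-! ## §5 Coordinate permutations of plane–plane covariances -/

/-- The plane–plane covariance as the centred two-point moment over `Fin 2`. [folklore] -/
theorem cov_plane_eq_torusE_prod (β : ℝ) (L : ℕ) (p q : Fin 4 × Fin 4) (x y : Site 4) :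
    torusE G r β L (fun V => plane G r p x V * plane G r q y V) - torusE G r β L (plane G r p x) * torusE G r β L (plane G r q y) =
      torusE G r β L (fun U => ∏ i : Fin 2, (plane G r (![p, q] i) (![x, y] i) U - torusE G r β L (plane G r (![p, q] i) (![x, y] i)))) := by
  have h : (fun U => ∏ i : Fin 2, (plane G r (![p, q] i) (![x, y] i) U - torusE G r β L (plane G r (![p, q] i) (![x, y] i)))) =
      fun U => (plane G r p x U - torusE G r β L (plane G r p x)) * (plane G r q y U - torusE G r β L (plane G r q y)) := by
    funext U
    simp [Fin.prod_univ_two]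
  rw [h, torusE_centred_centred G r β L (continuous_plane r p x) (continuous_plane r q y)
    (torusE G r β L (plane G r p x)) (torusE G r β L (plane G r q y))]
  ring

/-- **Plane–plane covariances are invariant under coordinate permutations** (planes re-sorted, sites permuted):
`Cov_T(plane_{πp} (π·x), plane_{πq} (π·y)) = Cov_T(plane_p x, plane_q y)` with `(π·x) i = x (π⁻¹ i)` (soft OS-assembly
toolkit XXIII, `torusMomentStr_coordPerm`). [folklore] -/
theorem cov_plane_perm (β : ℝ) (L : ℕ) (π : Equiv.Perm (Fin 4)) (p q : Fin 4 × Fin 4) (x y : Site 4) :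
    torusE G r β L (fun V => plane G r (permPlane π p) (fun i => x (π.symm i)) V *
          plane G r (permPlane π q) (fun i => y (π.symm i)) V) -
        torusE G r β L (plane G r (permPlane π p) (fun i => x (π.symm i))) *
          torusE G r β L (plane G r (permPlane π q) (fun i => y (π.symm i))) =
      torusE G r β L (fun V => plane G r p x V * plane G r q y V) -
        torusE G r β L (plane G r p x) * torusE G r β L (plane G r q y) := by
  rw [cov_plane_eq_torusE_prod, cov_plane_eq_torusE_prod]
  have key := torusMomentStr_coordPerm r β L π ![p, q] ![x, y]
  have h1 := torusE_prod_plane_eq_torusMomentStr r β L ![p, q] ![x, y]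
  have h2 := torusE_prod_plane_eq_torusMomentStr r β L ![permPlane π p, permPlane π q]
    ![fun i => x (π.symm i), fun i => y (π.symm i)]
  rw [h2, h1, key]
  have eO : (fun (i : Fin 2) (U : LGConfig 4 G) => plaquetteObs r.ρ 0 (![permPlane π p, permPlane π q] i).1
      (![permPlane π p, permPlane π q] i).2 U) =
      fun i U => plaquetteObs r.ρ 0 (permPlane π (![p, q] i)).1 (permPlane π (![p, q] i)).2 U := by
    funext i U; fin_cases i <;> rfl
  have eM : (fun i : Fin 2 => wilsonTorusMean r.ρ β L fun U => plaquetteObs r.ρ 0 (![permPlane π p, permPlane π q] i).1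
      (![permPlane π p, permPlane π q] i).2 U) =
      fun i => wilsonTorusMean r.ρ β L fun U => plaquetteObs r.ρ 0 (![p, q] i).1 (![p, q] i).2 U := by
    funext i
    fin_cases i
    · exact wilsonTorusMean_permPlane r β L π p
    · exact wilsonTorusMean_permPlane r β L π q
  have eS : (![fun i => x (π.symm i), fun i => y (π.symm i)] : Fin 2 → Site 4) = permSites π ![x, y] := by
    funext l i; fin_cases l <;> rfl
  rw [eO, eM, eS]

/-! ## §6 The ceiling at a time-dominant site, and at any site with a dominant coordinate -/

/-- **Ceiling at a time-dominant site.**  If `β ≥ 0`, `5 ≤ m_e`, `m_e + 1 ≤ L` and `m_e + 2 ≤ z₀ ≤ L`, then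
`Cov_T(plane_p 0, plane_q z)² ≤ D_p(m_e) · D_q(m_e)` (centring at `s = ⌊(z₀ − δ_p)/2⌋`, both diagonal lags land in
`[m_e, 2L+1−m_e]`, Hankel maximum principle). [cite: GlimmJaffe1987, §6.1] -/
theorem sq_cov_plane_le_edge {β : ℝ} (hβ : 0 ≤ β) {L : ℕ} {p q : Fin 4 × Fin 4} (hp : p.1 < p.2) (hq : q.1 < q.2)
    {me : ℕ} (hme5 : 5 ≤ me) (hmeL : me + 1 ≤ L) (z : Site 4) (hz1 : (me : ℤ) + 2 ≤ z 0) (hz2 : z 0 ≤ L) :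
    (torusE G r β L (fun V => plane G r p 0 V * plane G r q z V) -
        torusE G r β L (plane G r p 0) * torusE G r β L (plane G r q z)) ^ 2 ≤
      diagCov G r β L p me * diagCov G r β L q me := by
  have hL : 1 ≤ L := by omega
  obtain ⟨n, hn⟩ := Int.eq_ofNat_of_zero_le (show 0 ≤ z 0 by omega)
  have hcp : elec p = 0 ∨ elec p = 1 := by unfold elec; split_ifs <;> simp
  have hcq : elec q = 0 ∨ elec q = 1 := by unfold elec; split_ifs <;> simp
  -- the split
  set s : ℕ := (n - (elec p).toNat) / 2 with hs
  have hsp : (((elec p).toNat : ℕ) : ℤ) = elec p := Int.toNat_of_nonneg (elec_nonneg p)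
  have h2s : 2 * (s : ℤ) ≤ n - elec p ∧ (n : ℤ) - elec p ≤ 2 * s + 1 := by
    rcases hcp with h | h <;> simp only [h, Int.toNat_zero, Int.toNat_one] at hs ⊢ <;> omega
  have hy0 : 0 ≤ z 0 - s - elec p := by omega
  have hs2 : (s : ℤ) + 2 ≤ L := by omega
  have hy2 : z 0 - s - elec p + 2 ≤ L := by omega
  have key := sq_cov_plane_le_diagCov G r hβ hL hp hq z s hy0 hs2 hy2
  -- both lags in the Hankel window
  have hlp := diagCov_le_edge G r (L := L) hβ hp hme5 (by omega) (m := 2 * s + elec p) (by omega) (by omega)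
  have hlq := diagCov_le_edge G r (L := L) hβ hq hme5 (by omega) (m := 2 * (z 0 - s - elec p) + elec q)
    (by rcases hcq with h | h <;> rw [h] <;> omega) (by rcases hcq with h | h <;> rw [h] <;> omega)
  exact key.trans (mul_le_mul hlp.2 hlq.2 hlq.1 ((hlp.1).trans hlp.2))

/-- **Ceiling at any site with a dominant coordinate.**  If every diagonal kernel at the edge lag is at most `D`
(`D_{q'}(m_e) ≤ D` for all species `q'`), then for every site `z` with `m_e + 2 ≤ |z_i| ≤ L` for some coordinate `i`:
`Cov_T(plane_p 0, plane_q z)² ≤ D²` (coordinate permutation `0 ↔ i`, evenness for the sign, then the time-dominant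
case). [cite: GlimmJaffe1987, §6.1] -/
theorem sq_cov_plane_le_of_dominant {β : ℝ} (hβ : 0 ≤ β) {L : ℕ} {me : ℕ} (hme5 : 5 ≤ me) (hmeL : me + 1 ≤ L)
    {D : ℝ} (hD : ∀ q' : Fin 4 × Fin 4, q'.1 < q'.2 → diagCov G r β L q' me ≤ D) {p q : Fin 4 × Fin 4}
    (hp : p.1 < p.2) (hq : q.1 < q.2) (z : Site 4) (i : Fin 4) (hz1 : (me : ℤ) + 2 ≤ |z i|) (hz2 : |z i| ≤ L) :
    (torusE G r β L (fun V => plane G r p 0 V * plane G r q z V) -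
        torusE G r β L (plane G r p 0) * torusE G r β L (plane G r q z)) ^ 2 ≤ D ^ 2 := by
  -- non-negativity of the diagonal kernels at the edge lag, hence of `D`
  have hDnn : ∀ q' : Fin 4 × Fin 4, q'.1 < q'.2 → 0 ≤ diagCov G r β L q' me := fun q' hq' =>
    (diagCov_le_edge G r (L := L) hβ hq' hme5 (by omega) (m := me) le_rfl (by omega)).1
  have hD0 : 0 ≤ D := (hDnn p hp).trans (hD p hp)
  -- move the dominant coordinate to the time axis
  set π : Equiv.Perm (Fin 4) := Equiv.swap 0 i with hπ
  set z' : Site 4 := fun j => z (π.symm j) with hz'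
  have hz'0 : z' 0 = z i := by simp [hz', hπ, Equiv.swap_apply_left]
  have hperm := cov_plane_perm G r β L π p q 0 z
  have h0 : (fun j => (0 : Site 4) (π.symm j)) = 0 := by funext j; rfl
  rw [h0] at hperm
  rw [← hperm]
  have hp' := permPlane_valid π hp
  have hq' := permPlane_valid π hq
  -- the bound for time-dominant sites, both signs
  have main : ∀ (p₁ q₁ : Fin 4 × Fin 4), p₁.1 < p₁.2 → q₁.1 < q₁.2 → ∀ w : Site 4, (me : ℤ) + 2 ≤ w 0 → w 0 ≤ L →
      (torusE G r β L (fun V => plane G r p₁ 0 V * plane G r q₁ w V) -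
        torusE G r β L (plane G r p₁ 0) * torusE G r β L (plane G r q₁ w)) ^ 2 ≤ D ^ 2 := by
    intro p₁ q₁ hp₁ hq₁ w hw1 hw2
    refine (sq_cov_plane_le_edge G r hβ hp₁ hq₁ hme5 hmeL w hw1 hw2).trans ?_
    rw [sq]
    exact mul_le_mul (hD p₁ hp₁) (hD q₁ hq₁) (hDnn q₁ hq₁) hD0
  rcases le_or_gt 0 (z i) with hzi | hzi
  · rw [abs_of_nonneg hzi] at hz1 hz2
    exact main _ _ hp' hq' z' (by rw [hz'0]; exact hz1) (by rw [hz'0]; exact hz2)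
  · rw [abs_of_neg hzi] at hz1 hz2
    rw [show (fun j => z (π.symm j)) = -(-z') from (neg_neg _).symm,
      cov_plane_zero_neg r β L (permPlane π p) (permPlane π q) (-z')]
    exact main _ _ hq' hp' (-z') (by simp only [Pi.neg_apply, hz'0]; exact hz1)
      (by simp only [Pi.neg_apply, hz'0]; exact hz2)

/-! ## §7 The support item `HankelCeiling` -/

/-- **`UniversalDetector.HankelCeiling`** (stmt-QuantumFields-24000): for EVERY compact `G`, representation `r` and unit
`a → 0`, the one-annulus diagonal ceiling (EDGE) of `SchemeEdgeLaws` implies the TIGHT6 boundedness clause — every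
plane kernel `a⁻⁸ Cov_T(plane_p 0, plane_q z)` is bounded on the whole box off every femto ball `‖a z‖ ≥ η`, by the
(EDGE) constant at the scale `η' = min(η/8, η₀)`.  Mechanism: centring + RPCS + the Hankel maximum principle for the
reflection-positive, log-convex diagonal mirror sequences.  No summit, rung or crux is proved by this support item.
[cite: GlimmJaffe1987, §6.1] -/
theorem universalDetector_hankelCeiling : Summit.QuantumFields.YangMills.Theses.UniversalDetector.HankelCeiling := by
  intro G _ _ _ _
  letI : MeasurableSpace G := borel G
  haveI : BorelSpace G := ⟨rfl⟩
  intro r a ha hlim ker6 hE p q hp hq η hη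
  obtain ⟨η₀, hη₀, hE⟩ := hE
  -- the edge scale
  set η' : ℝ := min (η / 8) η₀ with hη'
  have hη'pos : 0 < η' := lt_min (by linarith) hη₀
  have hη'le : η' ≤ η / 8 := min_le_left _ _
  obtain ⟨CE, βE, ΛE, hEdge⟩ := hE η' hη'pos (min_le_right _ _)
  -- eventually `a β ≤ η'/5`
  have hsmall : ∀ᶠ β in Filter.atTop, a β ≤ η' / 5 :=
    (hlim.eventually (Iic_mem_nhds (show (0 : ℝ) < η' / 5 by linarith))).mono fun β h => h
  obtain ⟨βa, hβa⟩ := Filter.eventually_atTop.1 hsmall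
  refine ⟨CE, max (max βE βa) 0, max ΛE (2 * η'), fun β hβ L hL z hz hzη => ?_⟩
  have hβE : βE ≤ β := le_trans (le_trans (le_max_left _ _) (le_max_left _ _)) hβ
  have hβa' : a β ≤ η' / 5 := hβa β (le_trans (le_trans (le_max_right _ _) (le_max_left _ _)) hβ)
  have hβ0 : 0 ≤ β := le_trans (le_max_right _ _) hβ
  have hLE : ΛE ≤ a β * L := le_trans (le_max_left _ _) hL
  have hL2 : 2 * η' ≤ a β * L := le_trans (le_max_right _ _) hL
  have haβ := ha β
  -- the edge lag `m_e = ⌈η'/a⌉`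
  set me : ℕ := ⌈η' / a β⌉₊ with hme
  have hme1 : η' / a β ≤ me := Nat.le_ceil _
  have hme2 : (me : ℝ) < η' / a β + 1 := Nat.ceil_lt_add_one (div_nonneg hη'pos.le haβ.le)
  have h5 : (5 : ℝ) ≤ η' / a β := by rw [le_div_iff₀ haβ]; linarith
  have hme5 : 5 ≤ me := by exact_mod_cast h5.trans hme1
  have hmeL : me + 1 ≤ L := by
    have h1 : ((me : ℝ) + 1) < η' / a β + 2 := by linarith
    have h2 : η' / a β + η' / a β ≤ L := by
      rw [← add_div, div_le_iff₀ haβ]; linarith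
    have h3 : ((me + 1 : ℕ) : ℝ) < (L : ℝ) + 1 := by push_cast; linarith
    exact_mod_cast Nat.lt_add_one_iff.1 (by exact_mod_cast h3)
  have hame1 : η' ≤ a β * me := by rwa [div_le_iff₀' haβ] at hme1
  have hame2 : a β * me ≤ 2 * η' := by
    have : a β * me < η' + a β := by
      have := mul_lt_mul_of_pos_left hme2 haβ
      rwa [mul_add, mul_div_cancel₀ _ haβ.ne', mul_one] at this
    linarith
  -- the (EDGE) ceiling at the edge lag on the time axis, for every species
  have hDiag : ∀ q' : Fin 4 × Fin 4, q'.1 < q'.2 → diagCov G r β L q' me ≤ a β ^ 8 * CE := by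
    intro q' hq'
    have h := hEdge β hβE L hLE q' hq' 0 me hame1 hame2
    simp only [ker6] at h
    change |(a β)⁻¹ ^ 8 * diagCov G r β L q' me| ≤ CE at h
    rw [abs_mul, abs_of_pos (pow_pos (inv_pos.2 haβ) 8), inv_pow, ← div_eq_inv_mul,
      div_le_iff₀ (pow_pos haβ 8)] at h
    exact (le_abs_self _).trans (by linarith [h])
  -- a dominant coordinate: `m_e + 2 ≤ |z_i| ≤ L`
  have hbox : ∀ j, |z j| ≤ (L : ℤ) := by
    have hz' := hz; simp only [box, Fintype.mem_piFinset, Finset.mem_Icc] at hz'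
    exact fun j => abs_le.2 ⟨by linarith [(hz' j).1], (hz' j).2⟩
  have hdom : ∃ i, (me : ℤ) + 2 ≤ |z i| := by
    by_contra hcon
    push Not at hcon
    have hb : ∀ j, |(z j : ℝ)| ≤ (me : ℝ) + 1 := fun j => by
      have := hcon j
      have : |z j| ≤ (me : ℤ) + 1 := by omega
      exact_mod_cast this
    have hn := norm_siteToE_le_two_mul (by positivity) hb
    rw [norm_smul_siteToE haβ.le] at hzη
    have : a β * ‖siteToE z‖ ≤ a β * (2 * ((me : ℝ) + 1)) := mul_le_mul_of_nonneg_left hn haβ.le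
    have : a β * (2 * ((me : ℝ) + 1)) < η := by nlinarith [hame2, hβa', hη'le]
    linarith
  obtain ⟨i, hi⟩ := hdom
  have hsq := sq_cov_plane_le_of_dominant G r hβ0 hme5 hmeL hDiag hp hq z i hi (hbox i)
  have habs : |torusE G r β L (fun V => plane G r p 0 V * plane G r q z V) -
      torusE G r β L (plane G r p 0) * torusE G r β L (plane G r q z)| ≤ a β ^ 8 * CE := by
    have h := sq_le_sq.1 hsq
    have hDpos : 0 ≤ a β ^ 8 * CE := by
      have := hDiag p hp
      have h0 := (diagCov_le_edge G r (L := L) hβ0 hp hme5 (by omega) (m := me) le_rfl (by omega)).1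
      linarith
    rwa [abs_of_nonneg hDpos] at h
  simp only [ker6]
  rw [abs_mul, abs_of_pos (pow_pos (inv_pos.2 haβ) 8), inv_pow, ← div_eq_inv_mul, div_le_iff₀ (pow_pos haβ 8)]
  linarith

end Summit.QuantumFields.YangMills.Cruxes.UniversalDetectorHankel

end
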